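import Mathlib
import HarnessLib
import Summits.HubbardSuperconductivity.HubbardSuperconductivity.Theorems.KLProgrammeKLRegimeTwoVolumeLipDoubledTruncRemeasure
import Summits.HubbardSuperconductivity.HubbardSuperconductivity.Theorems.KLProgrammeKLRegimeTwoVolumeLipRowUnitsBase1

/-!
# Route `KLProgramme` — crux K3 ENGINE (stmt-HubbardSuperconductivity-20437 `KLRegimeEngineV17F2`), stub (e) proof-input «(e)-D-ROWS», keying (A′), REKEY-D file D7T:
# THE (Dμ)⁺ ROW OF THE SOURCE-TRUNCATED DOUBLED TOWER IN TRACK-`0` FLOOR UNITS WITH ONE BASE DATUM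
# (seat hubbard-kl-k3c4-p1 g28; truncated-doubled twin of ✓ `…TwoVolumeLipRowUnitsBase1.lipDiffArray_row_le_base1` over ✓ D6T-3 `klLipInputDiffSupDT_le_remeasured_base1`, with the
#  generic arithmetic ✓ `jumpCoeff_le` / `jumpCoeffBase_le` / `row_units_base_le` reused; `--supports` 23356)

* **`lipDiffArrayDT_row_le_base1`** — the truncated input difference of block `k ≥ 2` in floor units is at most the main terms `Σ_{k″∈[0,k]} (2ZC_J²)^m((32/2^m)^d)^{k+1−k″}·db k″`
  (`db` majorising `klLipBornDiffSupDT` of the blocks `1 ≤ k′ < k`), PLUS the base term `C_J^{2m}·((32/2^m)^d)^{k−1}·(32Z^m·klLipInputDiffSupDT … d 1 …/(ε·klLevUnitF))`, PLUS the row source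
  (far parts and coarse one-volume profiles of `klLipInputDT L … d 1` and `klLipBornDT L … d k′`).

Composition of landed theorems and real algebra (proof = the sector twin's); nothing asserts the (D) rows, stub (e), VL, K3 or superconductivity.
References: BGM 2006 §2.7 (2.71), §2.8 (2.93)–(2.98), §2.9 (4.3)–(4.6), §3 [cite: BenfattoGiulianiMastropietro2006].
-/

noncomputable section

namespace Summit.HubbardSuperconductivity.HubbardSuperconductivity.Theorems.TwoVolumeLip

set_option linter.dupNamespace false -- summit = problem name (single-conjunct summit), D-0017

open Finset Literature.MathematicalPhysics.QuantumLattice GrassmannAlgebra Literature.Probability.LatticeModels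
open Literature.MathematicalPhysics.QuantumLattice.FermiRG
open Summit.HubbardSuperconductivity.HubbardSuperconductivity.Theorems.KLRegimeSplit
open Summit.HubbardSuperconductivity.HubbardSuperconductivity.Theorems.KLProgrammeLegKernels
open Summit.HubbardSuperconductivity.HubbardSuperconductivity.Theorems.DispersionFlow
open Summit.HubbardSuperconductivity.HubbardSuperconductivity.Theorems.EngineV8
open Summit.HubbardSuperconductivity.HubbardSuperconductivity.Theorems.TwoVolumeSource
open Summit.HubbardSuperconductivity.HubbardSuperconductivity.Theorems.TwoVolumeDefect

section ModelBase1DT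

variable {L b M : ℕ} [NeZero L] [NeZero (b * L)] [NeZero M]

set_option maxHeartbeats 800000 in -- large statement
/-- **THE (Dμ)⁺ ROW OF THE SOURCE-TRUNCATED DOUBLED TOWER IN FLOOR UNITS, RE-BASED AT BLOCK 1** (truncated-doubled twin of ✓ `lipDiffArray_row_le_base1`, same arithmetic over ✓ D6T-3 `klLipInputDiffSupDT_le_remeasured_base1`; jump rows `cW k′, cW₁ ≥ 1`) (block `k ≥ 2`, `2 ≤ d`, degree `n + 1 = 2m`, depth `D₀ + r`, `2r ≤ D₀`, `R_in(1) ≤ D₀`): as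
`lipDiffArray_row_le` but over `klLipInputDiffSupDT_le_remeasured_base1`: the main terms `Σ_{k″∈[0,k]} (2ZC_J²)^m((32/2^m)^d)^{k+1−k″}·db k″`, the BASE term
`C_J^{2m}·((32/2^m)^d)^{k−1}·(32·Z^m·klLipInputDiffSup … d 1 (n+1) (R_in 1)/(ε·klLevUnitF β M 0 m (d−1)))` (rows of the base jump `≤ C_J·2^{dk−1−(d−1)}`), and the ROW
SOURCE (far parts and coarse profiles of the base input and of the born terms `1 ≤ k′ < k`). -/
theorem lipDiffArrayDT_row_le_base1 {β : ℝ} (hβ : 0 < β) (U μ : ℝ) (K : TrigPolyC4v) {d : ℕ} (hd : 2 ≤ d) {k : ℕ} (hk : 2 ≤ k)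
    {n m : ℕ} (hq : 2 * m = n + 1) (D₀ r jr : ℕ) (hD₀ : 2 * r ≤ D₀)
    {ΛT : ℝ} {cW : ℕ → ℝ} {cW₁ : ℝ} (hΛT : 0 ≤ ΛT) (hΛr : ΛT ≤ klScale klE0 jr) (hcW : ∀ k', 1 ≤ cW k') (hcW₁ : 1 ≤ cW₁)
    (hrow : ∀ k' ∈ Ico 1 k, ∀ x, ∑ y', ‖klJump (b * L) M β μ K (d * k - 1) (d * k') x y'‖ *
      klScaleWt (b * L) M β jr {latticeLegPos (2 * (2 * M)) x, latticeLegPos (2 * (2 * M)) y'} ≤ cW k')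
    (hcol : ∀ k' ∈ Ico 1 k, ∀ y', ∑ x, ‖klJump (b * L) M β μ K (d * k - 1) (d * k') x y'‖ *
      klScaleWt (b * L) M β jr {latticeLegPos (2 * (2 * M)) x, latticeLegPos (2 * (2 * M)) y'} ≤ cW k')
    (hrow₁ : ∀ x, ∑ y', ‖klJump (b * L) M β μ K (d * k - 1) (d * 1 - 1) x y'‖ *
      klScaleWt (b * L) M β jr {latticeLegPos (2 * (2 * M)) x, latticeLegPos (2 * (2 * M)) y'} ≤ cW₁)
    (hcol₁ : ∀ y', ∑ x, ‖klJump (b * L) M β μ K (d * k - 1) (d * 1 - 1) x y'‖ *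
      klScaleWt (b * L) M β jr {latticeLegPos (2 * (2 * M)) x, latticeLegPos (2 * (2 * M)) y'} ≤ cW₁)
    {CJ : ℝ} (hcWenv : ∀ k', 1 ≤ k' → k' < k → cW k' ≤ CJ * (2 : ℝ) ^ (d * k - 1 - d * k'))
    (hcW₁env : cW₁ ≤ CJ * (2 : ℝ) ^ (d * k - 1 - (d * 1 - 1)))
    {NI NIfar : ℝ} (hNI0 : 0 ≤ NI) (hNIfar0 : 0 ≤ NIfar)
    (hNI : ∀ (q : Fin (n + 1)) y, ∑ Y ∈ univ.filter (fun Y : Fin (n + 1) → SrcLabel L M (d * 1 - 1) => Y q = y),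
      ‖kernel ℂ (klLipInputDT L M β U μ K d 1) (n + 1) Y‖ ≤ NI)
    (hNIfar : ∀ (q : Fin (n + 1)) y (i : Fin (n + 1)),
      ∑ Y ∈ univ.filter (fun Y : Fin (n + 1) → SrcLabel L M (d * 1 - 1) => Y q = y ∧ r < Torus.tnorm ((Y q).1.1.2 - (Y i).1.1.2)),
        ‖kernel ℂ (klLipInputDT L M β U μ K d 1) (n + 1) Y‖ ≤ NIfar)
    {N Nfar : ℕ → ℝ} (hN0 : ∀ k', 0 ≤ N k') (hNfar0 : ∀ k', 0 ≤ Nfar k')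
    (hN : ∀ k' ∈ Ico 1 k, ∀ (q : Fin (n + 1)) (y : SrcLabel L M (d * k')),
      ∑ Y ∈ univ.filter (fun Y : Fin (n + 1) → SrcLabel L M (d * k') => Y q = y),
        ‖kernel ℂ (klLipBornDT L M β U μ K d k') (n + 1) Y‖ ≤ N k')
    (hNfar : ∀ k' ∈ Ico 1 k, ∀ (q : Fin (n + 1)) (y : SrcLabel L M (d * k')) (i : Fin (n + 1)),
      ∑ Y ∈ univ.filter (fun Y : Fin (n + 1) → SrcLabel L M (d * k') =>
          Y q = y ∧ r < Torus.tnorm ((Y q).1.1.2 - (Y i).1.1.2)), ‖kernel ℂ (klLipBornDT L M β U μ K d k') (n + 1) Y‖ ≤ Nfar k')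
    (Rout : ℕ → ℕ) (hdepth : ∀ k', 1 ≤ k' → k' < k → Rout k' ≤ D₀) (Rin₁ : ℕ) (hRin₁ : Rin₁ ≤ D₀)
    (db : ℕ → ℝ) (hdb0 : ∀ k'', 0 ≤ db k'')
    (hdb : ∀ k', 1 ≤ k' → k' < k →
      klLipBornDiffSupDT L b M β U μ K d k' (n + 1) (Rout k') ≤ db (k' + 1) * (imagTimeWeight β M * klLevUnitF β M 0 m (d * k')))
    {Z : ℝ} (hZ : 0 ≤ Z) :
    32 * Z ^ m * klLipInputDiffSupDT L b M β U μ K d k (n + 1) (D₀ + r) / (imagTimeWeight β M * klLevUnitF β M 0 m (d * k - 1)) ≤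
      (∑ k'' ∈ range (k + 1), (2 * Z * CJ ^ 2) ^ m * (((32 : ℝ) / 2 ^ m) ^ d) ^ (k + 1 - k'') * db k'') +
        CJ ^ (2 * m) * (((32 : ℝ) / 2 ^ m) ^ d) ^ (k - 1) *
          (32 * Z ^ m * klLipInputDiffSupDT L b M β U μ K d 1 (n + 1) Rin₁ / (imagTimeWeight β M * klLevUnitF β M 0 m (d * 1 - 1))) +
        32 * Z ^ m * ((cW₁ ^ n * (cW₁ / (1 + ΛT * ((r : ℝ) + 1)) * klLipInputDiffSupDT L b M β U μ K d 1 (n + 1) 0) +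
            (2 * cW₁ ^ n * (cW₁ / (1 + ΛT * ((r : ℝ) + 1))) * NI + n * cW₁ ^ n * (5 * (cW₁ / (1 + ΛT * ((r : ℝ) + 1))) * NI + 2 * cW₁ * NIfar))) +
          ∑ k' ∈ Ico 1 k, (cW k' ^ n * (cW k' / (1 + ΛT * ((r : ℝ) + 1)) * klLipBornDiffSupDT L b M β U μ K d k' (n + 1) 0) +
            (2 * cW k' ^ n * (cW k' / (1 + ΛT * ((r : ℝ) + 1))) * N k' +
              n * cW k' ^ n * (5 * (cW k' / (1 + ΛT * ((r : ℝ) + 1))) * N k' + 2 * cW k' * Nfar k')))) /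
          (imagTimeWeight β M * klLevUnitF β M 0 m (d * k - 1)) := by
  have hx : 0 < imagTimeWeight β M := imagTimeWeight_pos_of_pos (M := M) hβ
  have hU : 0 < imagTimeWeight β M * klLevUnitF β M 0 m (d * k - 1) := mul_pos hx (klLevUnitF_pos hβ 0 m _)
  have hU₁ : 0 < imagTimeWeight β M * klLevUnitF β M 0 m (d * 1 - 1) := mul_pos hx (klLevUnitF_pos hβ 0 m _)
  have hd1 : 1 ≤ d := by omega
  have hk1 : 1 ≤ k := by omega
  -- the row in absolute units, summands split into MAIN + REST
  set P : ℕ → ℝ := fun k' => cW k' ^ n * (cW k' * klLipBornDiffSupDT L b M β U μ K d k' (n + 1) D₀) with hP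
  set Q : ℕ → ℝ := fun k' => cW k' ^ n * (cW k' / (1 + ΛT * ((r : ℝ) + 1)) * klLipBornDiffSupDT L b M β U μ K d k' (n + 1) 0) +
    (2 * cW k' ^ n * (cW k' / (1 + ΛT * ((r : ℝ) + 1))) * N k' +
      n * cW k' ^ n * (5 * (cW k' / (1 + ΛT * ((r : ℝ) + 1))) * N k' + 2 * cW k' * Nfar k')) with hQ
  set P₁ : ℝ := cW₁ ^ n * (cW₁ * klLipInputDiffSupDT L b M β U μ K d 1 (n + 1) D₀) with hP₁
  set Q₁ : ℝ := cW₁ ^ n * (cW₁ / (1 + ΛT * ((r : ℝ) + 1)) * klLipInputDiffSupDT L b M β U μ K d 1 (n + 1) 0) +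
    (2 * cW₁ ^ n * (cW₁ / (1 + ΛT * ((r : ℝ) + 1))) * NI + n * cW₁ ^ n * (5 * (cW₁ / (1 + ΛT * ((r : ℝ) + 1))) * NI + 2 * cW₁ * NIfar)) with hQ₁
  have hS := klLipInputDiffSupDT_le_remeasured_base1 (L := L) (b := b) (M := M) hβ U μ K hd hk n D₀ r jr hD₀ hΛT hΛr hcW hcW₁ hrow hcol hrow₁ hcol₁
    hNI0 hNIfar0 hNI hNIfar hN0 hNfar0 hN hNfar
  have hS' : klLipInputDiffSupDT L b M β U μ K d k (n + 1) (D₀ + r) ≤ (P₁ + Q₁) + ∑ k' ∈ Ico 1 k, (P k' + Q k') := by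
    refine hS.trans (le_of_eq ?_)
    congr 1
    · simp only [hP₁, hQ₁]; ring
    · refine Finset.sum_congr rfl fun k' _ => ?_
      simp only [hP, hQ]; ring
  -- the main pieces in units
  have hmain : ∀ k', 1 ≤ k' → k' < k → (32 * Z ^ m) * P k' / (imagTimeWeight β M * klLevUnitF β M 0 m (d * k - 1)) ≤
      (2 * Z * CJ ^ 2) ^ m * (((32 : ℝ) / 2 ^ m) ^ d) ^ (k - k') * db (k' + 1) := by
    intro k' hk'1 hk'k
    have hc0 : 0 ≤ cW k' := zero_le_one.trans (hcW k')
    have hSb : klLipBornDiffSupDT L b M β U μ K d k' (n + 1) D₀ ≤ db (k' + 1) * (imagTimeWeight β M * klLevUnitF β M 0 m (d * k')) :=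
      (klLipBornDiffSupDT_anti β U μ K d k' (n + 1) (hdepth k' hk'1 hk'k)).trans (hdb k' hk'1 hk'k)
    have hcoef := jumpCoeff_le (β := β) (M := M) (m := m) hβ hd1 hk'k hZ hc0 (hcWenv k' hk'1 hk'k)
    have hpow : cW k' ^ n * cW k' = cW k' ^ (2 * m) := by rw [hq, pow_succ]
    calc (32 * Z ^ m) * P k' / (imagTimeWeight β M * klLevUnitF β M 0 m (d * k - 1))
        = (32 * Z ^ m * cW k' ^ (2 * m)) * klLipBornDiffSupDT L b M β U μ K d k' (n + 1) D₀ /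
            (imagTimeWeight β M * klLevUnitF β M 0 m (d * k - 1)) := by
          simp only [hP]; rw [← hpow]; ring
      _ ≤ (32 * Z ^ m * cW k' ^ (2 * m)) * (db (k' + 1) * (imagTimeWeight β M * klLevUnitF β M 0 m (d * k'))) /
            (imagTimeWeight β M * klLevUnitF β M 0 m (d * k - 1)) := by
          have h0 : 0 ≤ 32 * Z ^ m * cW k' ^ (2 * m) := by positivity
          exact div_le_div_of_nonneg_right (mul_le_mul_of_nonneg_left hSb h0) hU.le
      _ = (32 * Z ^ m * cW k' ^ (2 * m) * (klLevUnitF β M 0 m (d * k') / klLevUnitF β M 0 m (d * k - 1))) * db (k' + 1) := by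
          field_simp
      _ ≤ ((2 * Z * CJ ^ 2) ^ m * (((32 : ℝ) / 2 ^ m) ^ d) ^ (k - k')) * db (k' + 1) :=
          mul_le_mul_of_nonneg_right hcoef (hdb0 _)
  -- the base piece in units (`d * 1 - 1` is `simp`-normalised to `d - 1`: provide the nonvanishing facts in that form too)
  have hID0 : ∀ R, 0 ≤ klLipInputDiffSupDT L b M β U μ K d 1 (n + 1) R := fun R => klLipInputDiffSupDT_nonneg β U μ K d 1 (n + 1) R
  have hUd1 : klLevUnitF β M 0 m (d - 1) ≠ 0 := (klLevUnitF_pos hβ 0 m _).ne'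
  have hU1ne : klLevUnitF β M 0 m (d * 1 - 1) ≠ 0 := (klLevUnitF_pos hβ 0 m _).ne'
  have hUdk : klLevUnitF β M 0 m (d * k - 1) ≠ 0 := (klLevUnitF_pos hβ 0 m _).ne'
  have hxne : imagTimeWeight β M ≠ 0 := hx.ne'
  have hbase : (32 * Z ^ m) * P₁ / (imagTimeWeight β M * klLevUnitF β M 0 m (d * k - 1)) ≤
      CJ ^ (2 * m) * (((32 : ℝ) / 2 ^ m) ^ d) ^ (k - 1) *
        (32 * Z ^ m * klLipInputDiffSupDT L b M β U μ K d 1 (n + 1) Rin₁ / (imagTimeWeight β M * klLevUnitF β M 0 m (d * 1 - 1))) := by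
    have hSb : klLipInputDiffSupDT L b M β U μ K d 1 (n + 1) D₀ ≤ klLipInputDiffSupDT L b M β U μ K d 1 (n + 1) Rin₁ :=
      klLipInputDiffSupDT_anti β U μ K d 1 (n + 1) hRin₁
    have hcoef := jumpCoeffBase_le (β := β) (M := M) (m := m) hβ hd1 hk1 (zero_le_one.trans hcW₁) hcW₁env
    have hpow : cW₁ ^ n * cW₁ = cW₁ ^ (2 * m) := by rw [hq, pow_succ]
    have hset : klLipInputDiffSupDT L b M β U μ K d 1 (n + 1) Rin₁ =
        (klLipInputDiffSupDT L b M β U μ K d 1 (n + 1) Rin₁ / (imagTimeWeight β M * klLevUnitF β M 0 m (d * 1 - 1))) *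
          (imagTimeWeight β M * klLevUnitF β M 0 m (d * 1 - 1)) := by rw [div_mul_cancel₀ _ hU₁.ne']
    calc (32 * Z ^ m) * P₁ / (imagTimeWeight β M * klLevUnitF β M 0 m (d * k - 1))
        = (32 * Z ^ m * cW₁ ^ (2 * m)) * klLipInputDiffSupDT L b M β U μ K d 1 (n + 1) D₀ /
            (imagTimeWeight β M * klLevUnitF β M 0 m (d * k - 1)) := by
          simp only [hP₁]; rw [← hpow]; ring
      _ ≤ (32 * Z ^ m * cW₁ ^ (2 * m)) * klLipInputDiffSupDT L b M β U μ K d 1 (n + 1) Rin₁ /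
            (imagTimeWeight β M * klLevUnitF β M 0 m (d * k - 1)) := by
          have h0 : 0 ≤ 32 * Z ^ m * cW₁ ^ (2 * m) := by positivity
          exact div_le_div_of_nonneg_right (mul_le_mul_of_nonneg_left hSb h0) hU.le
      _ = (cW₁ ^ (2 * m) * (klLevUnitF β M 0 m (d * 1 - 1) / klLevUnitF β M 0 m (d * k - 1))) *
            (32 * Z ^ m * klLipInputDiffSupDT L b M β U μ K d 1 (n + 1) Rin₁ / (imagTimeWeight β M * klLevUnitF β M 0 m (d * 1 - 1))) := by
          field_simp
      _ ≤ (CJ ^ (2 * m) * (((32 : ℝ) / 2 ^ m) ^ d) ^ (k - 1)) *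
            (32 * Z ^ m * klLipInputDiffSupDT L b M β U μ K d 1 (n + 1) Rin₁ / (imagTimeWeight β M * klLevUnitF β M 0 m (d * 1 - 1))) :=
          mul_le_mul_of_nonneg_right hcoef (by have := hID0 Rin₁; positivity)
  have hχ : (0 : ℝ) ≤ ((32 : ℝ) / 2 ^ m) ^ d := by positivity
  have ha : (0 : ℝ) ≤ (2 * Z * CJ ^ 2) ^ m := by positivity
  have h := row_units_base_le (S := klLipInputDiffSupDT L b M β U μ K d k (n + 1) (D₀ + r)) (c := 32 * Z ^ m) (by positivity) hU ha hχ hdb0 hS' hmain hbase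
  refine (le_of_eq ?_).trans (h.trans (le_of_eq ?_))
  · ring
  · simp only [hQ, hQ₁]


end ModelBase1DT

end Summit.HubbardSuperconductivity.HubbardSuperconductivity.Theorems.TwoVolumeLip

end
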